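import Summits.Ventures.YMGap.RobustBall.LoopScreening
import Literature.MathematicalPhysics.QuantumLattice.ContinuumLimitLGT
import Literature.MathematicalPhysics.QuantumFieldTheory.LatticeGaugeShenZhuZhuProofs
import Literature.MathematicalPhysics.QuantumFieldTheory.LatticeGaugeDobrushin
import HarnessLib

/-!
# Venture YMGap, track ROBUST-BALL — THE PLAQUETTE NEVER FREEZES: a DLR variance floor for the plaquette observable of lattice
# Yang–Mills on `ℤ^d`, every DLR state, every coupling

HONEST FRAMING. WHAT THIS IS: a venture file (cell `pub-ymgap`, track Y2 ROBUST-BALL, seat ds-3, theorems only): the `ℤ^d`, infinite-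
volume twin of lit-1's torus variance floor (`LoopScreening.variance_wilsonLoop_ge`), for the PLAQUETTE observable
`W_p = Re tr ρ(U_p)` (tree `plaquetteObs ρ x i j`, `i ≠ j`) under ANY DLR state `μ ∈ ymGibbsMeasures ρ β` of the Wilson theory
with a continuous `N`-dimensional representation `ρ` of a compact group (`|Re tr ρ| ≤ N`):
* `plaquetteObs_glueWith_singleton` — on the one-link fibre of the first link `e₀ = (x, i)` through `η`, `W_p = N · f_ρ(ζ · P_η)`
  (`f_ρ = (1/N) Re tr ρ` the tree's `traceObs`, `P_η` the rest of the plaquette);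
* `integral_comp_plaquetteObs_fibre` — under the glued one-link Haar measure the law of `W_p` is the law of `N f_ρ` under Haar measure
  (right invariance);
* `kernel_integral_sq_sub_ge` — the one-link DLR kernel (Haar tilted by `−β S_{e₀}`, an energy of oscillation
  `≤ 2|β| · 2N · #(plaquettes ∋ e₀)`) spreads `W_p` around ANY constant by at least `e^{−2|β|·2N·#(plaquettes ∋ e₀)} · N² v_ρ`;
* ★★ `variance_plaquetteObs_ge` — for EVERY DLR state `μ` at EVERY `β`:
  `Var_μ(W_p) ≥ e^{−2|β|·2N·#(plaquettes ∋ e₀)} · N² v_ρ` (law of total variance, `le_integral_sq_sub_of_isGibbsMeasure`);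
* ★★ `variance_zdPlaquette_pos_SU` — `SU(N)`, `N ≥ 2`, fundamental representation, every `d`, every `β`, every DLR state:
  `Var_μ(W_p) > 0` (`haarTraceVariance_fundamentalRep_pos`), with the explicit floor `e^{−8N(d−1)|β|} N² v_N` through
  `card_plaquettesTouching_singleton_le`.
This is the first ingredient of the non-degeneracy (`χ > 0`) of the plaquette central limit theorem of `BoxSumCLTSU2.lean`; by itself it
says the single-plaquette marginal of every DLR state is non-degenerate, uniformly in the state.
WHAT THIS IS NOT: not `χ(W_p) = Σ_v cov(W_p, W_{p+v}) > 0` (that needs the off-diagonal covariances); lattice statement only.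
References: lit-1's `LoopScreeningTilt.lean` / `LoopScreening.lean` (the torus version, ported verbatim in structure); H.-O. Georgii (2011) §1.
-/

noncomputable section

open MeasureTheory ProbabilityTheory Real Finset
open Literature.Probability.LatticeModels hiding configShift configShift_apply
open Literature.MathematicalPhysics.QuantumFieldTheory hiding ZdEdge Site
open Literature.MathematicalPhysics.QuantumLattice
open Summit.Ventures.YMGap.RobustBall.LoopScreening

namespace Summit.Ventures.YMGap.RobustBall

namespace PlaquetteFloor

variable {d : ℕ} {G : Type*} [Group G] [TopologicalSpace G] [IsTopologicalGroup G] [CompactSpace G] [T2Space G]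
  [MeasurableSpace G] [BorelSpace G] [SecondCountableTopology G] {N : ℕ} {ρ : G →* Matrix (Fin N) (Fin N) ℂ}

/-! ### The plaquette on the one-link fibre of its first link -/

omit [Group G] [TopologicalSpace G] [IsTopologicalGroup G] [CompactSpace G] [T2Space G] [MeasurableSpace G] [BorelSpace G]
  [SecondCountableTopology G] in
/-- Gluing one link: `glueWith {e₀} ζ η` is `η` updated at `e₀`. [folklore] -/
theorem glueWith_singleton_apply (e₀ : ZdEdge d) (ζ : ↥({e₀} : Finset (ZdEdge d)) → G) (η : LGConfig d G) (e : ZdEdge d) :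
    glueWith {e₀} ζ η e = if e = e₀ then ζ ⟨e₀, Finset.mem_singleton_self e₀⟩ else η e := by
  by_cases he : e = e₀
  · subst he; rw [if_pos rfl, glueWith_apply_mem _ _ _ (Finset.mem_singleton_self e)]
  · rw [if_neg he, glueWith_apply_not_mem _ _ _ (by simpa using he)]

omit [TopologicalSpace G] [IsTopologicalGroup G] [CompactSpace G] [T2Space G] [MeasurableSpace G] [BorelSpace G]
  [SecondCountableTopology G] in
/-- **The plaquette on the fibre of its first link**: with all links but `e₀ = (x, i)` frozen at `η` (`i ≠ j`),
`W_{(x;i,j)} = N · f_ρ(ζ · P_η)` with `P_η = η_{(x+eᵢ, j)} η_{(x+eⱼ, i)}⁻¹ η_{(x, j)}⁻¹` the rest of the plaquette. [folklore] -/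
theorem plaquetteObs_glueWith_singleton {x : Site d} {i j : Fin d} (hij : i ≠ j) (ζ : ↥({(x, i)} : Finset (ZdEdge d)) → G)
    (η : LGConfig d G) :
    plaquetteObs ρ x i j (glueWith {(x, i)} ζ η) =
      N * traceObs ρ (ζ ⟨(x, i), Finset.mem_singleton_self _⟩ *
        (η (x + Pi.single i 1, j) * (η (x + Pi.single j 1, i))⁻¹ * (η (x, j))⁻¹)) := by
  have hne1 : ((x + Pi.single i 1, j) : ZdEdge d) ≠ (x, i) := fun h => hij (Prod.mk.inj h).2.symm
  have hne2 : ((x + Pi.single j 1, i) : ZdEdge d) ≠ (x, i) := fun h => by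
    have h1 := congr_fun (Prod.mk.inj h).1 j
    simp at h1
  have hne3 : ((x, j) : ZdEdge d) ≠ (x, i) := fun h => hij (Prod.mk.inj h).2.symm
  rw [plaquetteObs, plaquetteHolonomyZd, glueWith_singleton_apply, glueWith_singleton_apply, glueWith_singleton_apply,
    glueWith_singleton_apply, if_pos rfl, if_neg hne1, if_neg hne2, if_neg hne3, traceObs]
  rcases Nat.eq_zero_or_pos N with hN | hN
  · subst hN
    simp [Matrix.trace]
  · have hN' : (N : ℝ) ≠ 0 := by exact_mod_cast hN.ne'
    rw [← mul_assoc, mul_inv_cancel₀ hN', one_mul]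
    simp only [mul_assoc]

omit [T2Space G] in
/-- **Transport of fibre integrals to Haar integrals**: on the one-link fibre of `e₀ = (x, i)` through `η`, the law of `W_p` under the
glued Haar measure is the law of `N f_ρ` under Haar measure (`e₀` enters once; Haar measure is right invariant). [folklore] -/
theorem integral_comp_plaquetteObs_fibre (hρ : Continuous ρ) {x : Site d} {i j : Fin d} (hij : i ≠ j) (η : LGConfig d G)
    {F : ℝ → ℝ} (hF : Continuous F) :
    ∫ U, F (plaquetteObs ρ x i j U)
        ∂((Measure.pi fun _ : ↥({(x, i)} : Finset (ZdEdge d)) => haarProbability G).map (glueWith {(x, i)} · η)) =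
      ∫ g, F (N * traceObs ρ g) ∂haarProbability G := by
  set P : G := η (x + Pi.single i 1, j) * (η (x + Pi.single j 1, i))⁻¹ * (η (x, j))⁻¹ with hP
  have hFc : Continuous fun U : LGConfig d G => F (plaquetteObs ρ x i j U) := hF.comp (continuous_plaquetteObs ρ hρ x i j)
  rw [integral_map (measurable_glueWith _ η).aemeasurable hFc.measurable.aestronglyMeasurable]
  have hrw : ∀ ζ : ↥({(x, i)} : Finset (ZdEdge d)) → G,
      F (plaquetteObs ρ x i j (glueWith {(x, i)} ζ η)) = F (N * traceObs ρ (ζ ⟨(x, i), Finset.mem_singleton_self _⟩ * P)) :=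
    fun ζ => by rw [plaquetteObs_glueWith_singleton hij]
  simp_rw [hrw]
  have hev := measurePreserving_eval (fun _ : ↥({(x, i)} : Finset (ZdEdge d)) => haarProbability G)
    ⟨(x, i), Finset.mem_singleton_self _⟩
  have hGc : Continuous fun g : G => F (N * traceObs ρ (g * P)) :=
    hF.comp (continuous_const.mul ((continuous_traceObs hρ).comp (continuous_id.mul continuous_const)))
  have h1 : ∫ ζ, F (N * traceObs ρ (ζ ⟨(x, i), Finset.mem_singleton_self _⟩ * P))
      ∂(Measure.pi fun _ : ↥({(x, i)} : Finset (ZdEdge d)) => haarProbability G) = ∫ g, F (N * traceObs ρ (g * P)) ∂haarProbability G := by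
    have h := integral_map (μ := Measure.pi fun _ : ↥({(x, i)} : Finset (ZdEdge d)) => haarProbability G)
      hev.measurable.aemeasurable (f := fun g : G => F (N * traceObs ρ (g * P))) hGc.measurable.aestronglyMeasurable
    rw [hev.map_eq] at h
    exact h.symm
  rw [h1]
  have hinv := measurePreserving_mul_mul_inv_haarProbability (G := G) 1 P⁻¹
  have hGc' : Continuous fun g : G => F (N * traceObs ρ g) := hF.comp (continuous_const.mul (continuous_traceObs hρ))
  have h2 := integral_map (μ := haarProbability G) hinv.measurable.aemeasurable (f := fun g : G => F (N * traceObs ρ g))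
    hGc'.measurable.aestronglyMeasurable
  rw [hinv.map_eq] at h2
  rw [h2]
  simp only [one_mul, inv_inv]

/-! ### The one-link variance floor -/

omit [TopologicalSpace G] [IsTopologicalGroup G] [CompactSpace G] [T2Space G] [MeasurableSpace G] [BorelSpace G]
  [SecondCountableTopology G] in
/-- The one-link boundary Wilson action is between `0` and `2N · #(plaquettes ∋ e₀)` when `|Re tr ρ| ≤ N`. [folklore] -/
theorem wilsonBoundaryAction_singleton_mem (hM : ∀ g, |(ρ g).trace.re| ≤ N) (e₀ : ZdEdge d) (U : LGConfig d G) :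
    0 ≤ wilsonBoundaryAction ρ {e₀} U ∧ wilsonBoundaryAction ρ {e₀} U ≤ 2 * N * (plaquettesTouching {e₀}).card := by
  unfold wilsonBoundaryAction
  constructor
  · refine Finset.sum_nonneg fun p _ => ?_
    have := (abs_le.1 (hM (plaquetteHolonomyZd U p.1 p.2.1.1 p.2.1.2))).2
    unfold plaquetteObs; linarith
  · calc ∑ p ∈ plaquettesTouching {e₀}, ((N : ℝ) - plaquetteObs ρ p.1 p.2.1.1 p.2.1.2 U)
        ≤ ∑ _p ∈ plaquettesTouching {e₀}, (2 * (N : ℝ)) := Finset.sum_le_sum fun p _ => by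
          have := (abs_le.1 (hM (plaquetteHolonomyZd U p.1 p.2.1.1 p.2.1.2))).1
          unfold plaquetteObs; linarith
      _ = 2 * N * (plaquettesTouching {e₀}).card := by rw [Finset.sum_const, nsmul_eq_mul]; ring

omit [T2Space G] in
/-- **One-link variance floor of the Wilson kernels on `ℤ^d`.** For every boundary condition `η` and every constant `c`, the one-link
DLR kernel at the first link `e₀ = (x, i)` spreads `W_p` around `c` by at least `e^{−2|β|·2N·#(plaquettes ∋ e₀)} · N² v_ρ`: the kernel is
Haar measure on the link tilted by an energy of oscillation `≤ 2|β|·2N·#(plaquettes ∋ e₀)`, and under Haar measure `W_p` has the law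
of `N f_ρ`, whose mean square deviation from any constant is `≥ N² v_ρ`. [folklore] -/
theorem kernel_integral_sq_sub_ge (hρ : Continuous ρ) (hM : ∀ g, |(ρ g).trace.re| ≤ N) (β : ℝ) {x : Site d} {i j : Fin d}
    (hij : i ≠ j) (η : LGConfig d G) (c : ℝ) :
    exp (-(2 * |β| * (2 * N * (plaquettesTouching {((x, i) : ZdEdge d)}).card))) * ((N : ℝ) ^ 2 * haarTraceVariance ρ) ≤
      ∫ U, (plaquetteObs ρ x i j U - c) ^ 2 ∂(ymSpecification (d := d) ρ β {(x, i)} η) := by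
  set ν := (Measure.pi fun _ : ↥({(x, i)} : Finset (ZdEdge d)) => haarProbability G).map (glueWith {(x, i)} · η) with hν
  haveI : IsProbabilityMeasure ν := Measure.isProbabilityMeasure_map (measurable_glueWith _ η).aemeasurable
  set D : ℝ := 2 * |β| * (2 * N * (plaquettesTouching {((x, i) : ZdEdge d)}).card) with hD
  have hWb : ∀ U : LGConfig d G, |plaquetteObs ρ x i j U| ≤ N := fun U => hM _
  -- the tilt is an energy of oscillation `≤ D`
  have hφ : ∀ U : LGConfig d G, -(D / 2) ≤ -β * wilsonBoundaryAction ρ {(x, i)} U ∧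
      -β * wilsonBoundaryAction ρ {(x, i)} U ≤ -(D / 2) + D := by
    intro U
    obtain ⟨h0, h1⟩ := wilsonBoundaryAction_singleton_mem hM ((x, i) : ZdEdge d) U
    have hSb : |wilsonBoundaryAction ρ {(x, i)} U| ≤ 2 * N * (plaquettesTouching {((x, i) : ZdEdge d)}).card := abs_le.2 ⟨by linarith, h1⟩
    have hprod : |β * wilsonBoundaryAction ρ {(x, i)} U| ≤ D / 2 := by
      rw [abs_mul, hD]
      have := mul_le_mul_of_nonneg_left hSb (abs_nonneg β)
      linarith
    constructor <;> [have := (abs_le.1 hprod).2; have := (abs_le.1 hprod).1] <;> linarith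
  -- Haar side: `∫ F(W_p) dν = ∫ F(N f_ρ) dHaar ≥ N² v_ρ`
  have hfloor : (N : ℝ) ^ 2 * haarTraceVariance ρ ≤ ∫ U, (plaquetteObs ρ x i j U - c) ^ 2 ∂ν := by
    rw [hν, integral_comp_plaquetteObs_fibre hρ hij η (F := fun r => (r - c) ^ 2) (by fun_prop)]
    rcases Nat.eq_zero_or_pos N with hN | hN
    · subst hN
      simp only [Nat.cast_zero, ne_eq, OfNat.ofNat_ne_zero, not_false_eq_true, zero_pow, zero_mul]
      exact integral_nonneg fun g => sq_nonneg _
    have hN' : (0 : ℝ) < N := by exact_mod_cast hN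
    have hf1 : ∀ g, |traceObs ρ g| ≤ 1 := abs_traceObs_le_one hM
    have hmin := integral_sq_sub_integral_le (ν := haarProbability G) (continuous_traceObs hρ).measurable hf1 (c / N)
    have hscale : ∀ g, ((N : ℝ) * traceObs ρ g - c) ^ 2 = (N : ℝ) ^ 2 * (traceObs ρ g - c / N) ^ 2 := fun g => by
      field_simp
    simp_rw [hscale]
    rw [integral_const_mul]
    exact mul_le_mul_of_nonneg_left hmin (sq_nonneg _)
  -- tilt
  have htilt := exp_neg_mul_integral_sq_le_integral_tilted (ν := ν) (continuous_plaquetteObs ρ hρ x i j).measurable hWb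
    ((continuous_const.mul (continuous_wilsonBoundaryAction ρ hρ _)).measurable) (Filter.Eventually.of_forall hφ) c
  unfold ymSpecification
  rw [← hν]
  calc exp (-D) * ((N : ℝ) ^ 2 * haarTraceVariance ρ) ≤ exp (-D) * ∫ U, (plaquetteObs ρ x i j U - c) ^ 2 ∂ν :=
        mul_le_mul_of_nonneg_left hfloor (exp_nonneg _)
    _ ≤ _ := htilt

/-! ### The variance floor under every DLR state -/

/-- ★★ **THE PLAQUETTE NEVER FREEZES**: for every DLR state `μ` of the Wilson theory at coupling `β` (continuous `ρ`, `|Re tr ρ| ≤ N`)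
and every plaquette `(x; i, j)`, `i ≠ j`:
`Var_μ(W_p) = ∫ (W_p − μ W_p)² dμ ≥ e^{−2|β|·2N·#(plaquettes ∋ (x,i))} · N² v_ρ` (law of total variance through the one-link kernel).
[folklore] -/
theorem variance_plaquetteObs_ge (hρ : Continuous ρ) (hM : ∀ g, |(ρ g).trace.re| ≤ N) {β : ℝ} {μ : Measure (LGConfig d G)}
    (hμ : μ ∈ ymGibbsMeasures (d := d) ρ β) {x : Site d} {i j : Fin d} (hij : i ≠ j) :
    exp (-(2 * |β| * (2 * N * (plaquettesTouching {((x, i) : ZdEdge d)}).card))) * ((N : ℝ) ^ 2 * haarTraceVariance ρ) ≤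
      ∫ U, (plaquetteObs ρ x i j U - ∫ U', plaquetteObs ρ x i j U' ∂μ) ^ 2 ∂μ :=
  le_integral_sq_sub_of_isGibbsMeasure (isSpecification_ymSpecification_of_t2Space (d := d) ρ hρ β) hμ {(x, i)}
    (continuous_plaquetteObs ρ hρ x i j).measurable (fun _ => hM _) fun η c => kernel_integral_sq_sub_ge hρ hM β hij η c

/-- ★★ **`SU(N)`, `N ≥ 2`, EVERY `d`, EVERY `β`, EVERY DLR STATE: the plaquette variance is strictly positive**, with the explicit floor
`Var_μ(W_p) ≥ e^{−8N(d−1)|β|} N² v_N`, `v_N = haarTraceVariance (fundamentalRep (Fin N)) > 0` (at most `2(d−1)` plaquettes contain a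
link). [folklore] -/
theorem variance_zdPlaquette_ge_SU {N : ℕ} (hN : 2 ≤ N) {β : ℝ} {μ : Measure (LGConfig d (Matrix.specialUnitaryGroup (Fin N) ℂ))}
    (hμ : μ ∈ ymGibbsMeasures (d := d) (fundamentalRep (Fin N)) β) {x : Site d} {i j : Fin d} (hij : i ≠ j) :
    exp (-(8 * N * ((d : ℝ) - 1) * |β|)) * ((N : ℝ) ^ 2 * haarTraceVariance (fundamentalRep (Fin N))) ≤
      ∫ U, (plaquetteObs (fundamentalRep (Fin N)) x i j U - ∫ U', plaquetteObs (fundamentalRep (Fin N)) x i j U' ∂μ) ^ 2 ∂μ := by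
  have hM : ∀ g : Matrix.specialUnitaryGroup (Fin N) ℂ, |((fundamentalRep (Fin N)) g).trace.re| ≤ N := abs_trace_re_le_of_specialUnitary
  have h := variance_plaquetteObs_ge (continuous_fundamentalRep (Fin N)) hM hμ hij (x := x)
  refine le_trans (mul_le_mul_of_nonneg_right (exp_le_exp.2 ?_) (by
    have := (haarTraceVariance_fundamentalRep_pos hN).le; positivity)) h
  have hcard : ((plaquettesTouching {((x, i) : ZdEdge d)}).card : ℝ) ≤ 2 * ((d : ℝ) - 1) := by
    have h := card_plaquettesTouching_singleton_le ((x, i) : ZdEdge d)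
    have hd : 1 ≤ d := by
      rcases Nat.eq_zero_or_pos d with hd | hd
      · subst hd; exact i.elim0
      · exact hd
    have : ((2 * (d - 1) : ℕ) : ℝ) = 2 * ((d : ℝ) - 1) := by push_cast [Nat.cast_sub hd]; ring
    rw [← this]; exact_mod_cast h
  have hN0 : (0 : ℝ) ≤ N := Nat.cast_nonneg _
  nlinarith [abs_nonneg β, mul_nonneg (mul_nonneg (abs_nonneg β) hN0) (sub_nonneg.2 (show ((plaquettesTouching {((x, i) : ZdEdge d)}).card : ℝ) ≤ 2 * ((d : ℝ) - 1) from hcard))]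

/-- ★★ **Corollary: `Var_μ(W_p) > 0`** for `SU(N)`, `N ≥ 2`, every `d`, `β`, DLR state and plaquette. [folklore] -/
theorem variance_zdPlaquette_pos_SU {N : ℕ} (hN : 2 ≤ N) {β : ℝ} {μ : Measure (LGConfig d (Matrix.specialUnitaryGroup (Fin N) ℂ))}
    (hμ : μ ∈ ymGibbsMeasures (d := d) (fundamentalRep (Fin N)) β) {x : Site d} {i j : Fin d} (hij : i ≠ j) :
    0 < ∫ U, (plaquetteObs (fundamentalRep (Fin N)) x i j U - ∫ U', plaquetteObs (fundamentalRep (Fin N)) x i j U' ∂μ) ^ 2 ∂μ := by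
  refine lt_of_lt_of_le ?_ (variance_zdPlaquette_ge_SU hN hμ hij)
  have hv := haarTraceVariance_fundamentalRep_pos hN
  have hN0 : (0 : ℝ) < N := by exact_mod_cast (by omega : 0 < N)
  positivity

end PlaquetteFloor

end Summit.Ventures.YMGap.RobustBall

end
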